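import Mathlib
import Summits.MatrixMultiplication.MatrixMultiplication.Theses.GLnSeparatingDesigns
import Summits.MatrixMultiplication.MatrixMultiplication.Theorems.SeparationDegreeCost.Negative.FixedTolerance
import Literature.Computability.AlgebraicComplexity.MatrixMultiplicationExponent
import Literature.Computability.AlgebraicComplexity.FlatteningBound

/-!
# `GLnSeparatingDesigns.SeparationDegreeCost` (stmt-MatrixMultiplication-18361) — Negative lane III:
# the degree bound and the cross terms `y ≠ y'`

Sequel of `Negative/FixedTolerance.lean` (same conventions: no Theses statement asserted positively;
`DesignAt`, `Conclusion`, `designAt_of_points`, `toGL`, the 576-point design `design576` and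
`not_conclusion_576` from there).

* `separationDegreeCost_noDegreeBound_false` — the degree bound `p.totalDegree ≤ s` is load-bearing:
  the SAME 576 points are EXACTLY separated by the degree-`575` products
  `Π_{x ≠ x₀} (4 − ⟨x, g⟩)/(4 − ⟨x, x₀⟩)` (`lagrange576`; well defined as `⟨x, x₀⟩ ≤ 3`), so without the
  bound the price at `s = 2` is violated (`not_conclusion_576`).  Contrast: in degree `2` these points
  are only `3/7`-separated (`designAt_576`) — exact separation of `N` points by `Pol_{≤ s}` needs
  `N ≤ C(s+9, 9)`.
* `separationDegreeCost_noCross_false` — the cross terms are load-bearing: if the separators are only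
  constrained at the products `x y⁻¹ y z⁻¹ = x z⁻¹` (no `y ≠ y'`), then `X = Z = {1}`, `Y` = the 576
  points, `p = 1` is a design at every `s`, and `N₂ = 576` violates the bound at `s = 2`: the vanishing
  at `x y⁻¹ y' z⁻¹`, `y ≠ y'`, is exactly what makes `|Y|` enter the price.
-/

-- `Summit.<S>.<S>.…` repeats `MatrixMultiplication` (summit = sub-problem) by design (lakefile: linter off).
set_option linter.dupNamespace false

namespace Summit.MatrixMultiplication.MatrixMultiplication.Theorems

open scoped BigOperators
open Literature.Computability.AlgebraicComplexity
open Summit.MatrixMultiplication.MatrixMultiplication.Theses.GLnSeparatingDesigns (SeparationDegreeCost)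

namespace SeparationDegreeCostNeg

/-! ## The degree bound: the same 576 points are EXACTLY separated in degree `575` -/

/-- The exact (Lagrange-type) separator of the target `x₀ = design576 p₀` WITHOUT degree bound:
`Π_{x ≠ x₀} (4 − ⟨x, g⟩)/(4 − ⟨x, x₀⟩)` (well defined since `⟨x, x₀⟩ ≤ 3 < 4 = ⟨x, x⟩`). [folklore] -/
noncomputable def lagrange576 (p₀ : Param) : MvPolynomial (Fin 3 × Fin 3) ℂ :=
  ∏ p ∈ (Finset.univ : Finset Param).erase p₀,
    MvPolynomial.C ((4 - (ip (design576 p) (design576 p₀) : ℂ))⁻¹) *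
      (MvPolynomial.C 4 - lin (design576 p))

/-- Value of the exact separator at a design point: `1` at the target, `0` elsewhere. [folklore] -/
theorem eval_lagrange576 (p₀ q : Param) :
    MvPolynomial.eval (fun ij : Fin 3 × Fin 3 => castM (design576 q) ij.1 ij.2) (lagrange576 p₀) =
      if q = p₀ then 1 else 0 := by
  unfold lagrange576
  rw [map_prod]
  simp only [map_mul, map_sub, MvPolynomial.eval_C, eval_lin]
  split_ifs with hq
  · subst hq
    refine Finset.prod_eq_one fun p hp => ?_
    have hne : design576 p ≠ design576 q := fun h => (Finset.mem_erase.1 hp).1 (design576_injective h)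
    have h3 := (ip_bounds (design576_good p).1 (design576_good q).1 hne).2
    have h4 : (4 : ℂ) - (ip (design576 p) (design576 q) : ℂ) ≠ 0 := by
      have : ((4 - ip (design576 p) (design576 q) : ℤ) : ℂ) ≠ 0 := by exact_mod_cast (by omega)
      push_cast at this
      exact this
    exact inv_mul_cancel₀ h4
  · refine Finset.prod_eq_zero (Finset.mem_erase.2 ⟨hq, Finset.mem_univ q⟩) ?_
    rw [(design576_good q).1]
    push_cast
    ring

/-- The design clause with the degree bound `p.totalDegree ≤ s` DELETED. [folklore] -/
def DesignAtNoDegree (n N₁ N₂ N₃ : ℕ) (η : ℝ) : Prop :=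
  ∃ X Y Z : Finset (Matrix.GeneralLinearGroup (Fin n) ℂ), N₁ ≤ X.card ∧ N₂ ≤ Y.card ∧ N₃ ≤ Z.card ∧ (∀ x ∈ X, ∀ x' ∈ X, ∀ y ∈ Y, ∀ y' ∈ Y, ∀ z ∈ Z, ∀ z' ∈ Z, x * y⁻¹ * y' * z⁻¹ = x' * z'⁻¹ → x = x' ∧ y = y' ∧ z = z') ∧ ∀ x₀ ∈ X, ∀ z₀ ∈ Z, ∃ p : MvPolynomial (Fin n × Fin n) ℂ, ∀ x ∈ X, ∀ y ∈ Y, ∀ y' ∈ Y, ∀ z ∈ Z, ((x = x₀ ∧ y = y' ∧ z = z₀) → ‖MvPolynomial.eval (fun ij : Fin n × Fin n => ((x * y⁻¹ * y' * z⁻¹ : Matrix.GeneralLinearGroup (Fin n) ℂ) : Matrix (Fin n) (Fin n) ℂ) ij.1 ij.2) p - 1‖ ≤ η) ∧ (¬ (x = x₀ ∧ y = y' ∧ z = z₀) → ‖MvPolynomial.eval (fun ij : Fin n × Fin n => ((x * y⁻¹ * y' * z⁻¹ : Matrix.GeneralLinearGroup (Fin n) ℂ) : Matrix (Fin n) (Fin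 n) ℂ) ij.1 ij.2) p‖ ≤ η)

/-- Forgetting the degree bound: `DesignAt n s N η → DesignAtNoDegree n N η`, and conversely a design
without degree bound is a design at degree `s` for SOME `s`. [folklore] -/
theorem designAtNoDegree_iff (n N₁ N₂ N₃ : ℕ) (η : ℝ) :
    DesignAtNoDegree n N₁ N₂ N₃ η ↔ ∃ s, DesignAt n s N₁ N₂ N₃ η := by
  classical
  constructor
  · rintro ⟨X, Y, Z, hX, hY, hZ, htpp, hsep⟩
    choose p hp using hsep
    refine ⟨X.attach.sup fun x => Z.attach.sup fun z => (p x.1 x.2 z.1 z.2).totalDegree,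
      X, Y, Z, hX, hY, hZ, htpp, fun x₀ hx₀ z₀ hz₀ => ⟨p x₀ hx₀ z₀ hz₀, ?_, hp x₀ hx₀ z₀ hz₀⟩⟩
    have h1 : (p x₀ hx₀ z₀ hz₀).totalDegree ≤
        (Z.attach.sup fun z => (p x₀ hx₀ z.1 z.2).totalDegree) :=
      Finset.le_sup (f := fun z : {z // z ∈ Z} => (p x₀ hx₀ z.1 z.2).totalDegree)
        (Finset.mem_attach Z ⟨z₀, hz₀⟩)
    exact h1.trans (Finset.le_sup
      (f := fun x : {x // x ∈ X} => Z.attach.sup fun z => (p x.1 x.2 z.1 z.2).totalDegree)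
      (Finset.mem_attach X ⟨x₀, hx₀⟩))
  · rintro ⟨s, X, Y, Z, hX, hY, hZ, htpp, hsep⟩
    exact ⟨X, Y, Z, hX, hY, hZ, htpp, fun x₀ hx₀ z₀ hz₀ =>
      let ⟨p, _, hp⟩ := hsep x₀ hx₀ z₀ hz₀; ⟨p, hp⟩⟩

/-- **The 576 points, exactly separated (degree 575), at every tolerance.** [folklore] -/
theorem designAtNoDegree_576 {η : ℝ} (hη : 0 ≤ η) : DesignAtNoDegree 3 576 1 1 η := by
  classical
  rw [designAtNoDegree_iff]
  refine ⟨(lagrange576 default).totalDegree ⊔ Finset.univ.sup fun p₀ => (lagrange576 p₀).totalDegree, ?_⟩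
  set X : Finset (Matrix.GeneralLinearGroup (Fin 3) ℂ) :=
    (Finset.univ : Finset Param).image fun p => toGL (design576 p) with hX
  have hinj : Function.Injective fun p : Param => toGL (design576 p) := fun p q h =>
    design576_injective (toGL_inj (design576_good p).2 (design576_good q).2 h)
  have hcard : X.card = 576 := by
    rw [hX, Finset.card_image_of_injective _ hinj, Finset.card_univ, card_param576]
  rw [← hcard]
  refine designAt_of_points X fun x₀ hx₀ => ?_
  obtain ⟨p₀, -, rfl⟩ := Finset.mem_image.1 hx₀
  refine ⟨lagrange576 p₀, le_sup_of_le_right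
    (Finset.le_sup (f := fun q => (lagrange576 q).totalDegree) (Finset.mem_univ p₀)), fun x hx => ?_⟩
  obtain ⟨p, -, rfl⟩ := Finset.mem_image.1 hx
  rw [val_toGL (design576_good p).2, eval_lagrange576]
  refine ⟨fun hxx => ?_, fun hxx => ?_⟩
  · rw [if_pos (hinj hxx)]; simp [hη]
  · rw [if_neg fun h => hxx (by rw [h])]; simp [hη]

/-- Deleting the degree bound is a STRENGTHENING of the crux (statement written out). [folklore] -/
theorem separationDegreeCost_of_noDegreeBound
    (h : ∀ n : ℕ, 3 ≤ n → ∀ s : ℕ, 2 ≤ s → ∀ N₁ N₂ N₃ : ℕ,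
      (∀ η : ℝ, 0 < η → DesignAtNoDegree n N₁ N₂ N₃ η) → Conclusion n s N₁ N₂ N₃) :
    SeparationDegreeCost :=
  fun n hn s hs N₁ N₂ N₃ hd => h n hn s hs N₁ N₂ N₃ fun η hη =>
    (designAtNoDegree_iff n N₁ N₂ N₃ η).2 ⟨s, hd η hη⟩

/-- **The degree bound is load-bearing**: every finite point set in `GL₃(ℂ)` is exactly separated by
polynomials of SOME degree (here the 576 design points, degree `575`), so without `p.totalDegree ≤ s`
the bound at `s = 2` fails (`not_conclusion_576`).  Contrast: the same points are only
`3/7`-separated in degree `2` (`designAt_576`). [folklore] -/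
theorem separationDegreeCost_noDegreeBound_false :
    ¬ ∀ n : ℕ, 3 ≤ n → ∀ s : ℕ, 2 ≤ s → ∀ N₁ N₂ N₃ : ℕ,
      (∀ η : ℝ, 0 < η → DesignAtNoDegree n N₁ N₂ N₃ η) → Conclusion n s N₁ N₂ N₃ :=
  fun h => not_conclusion_576 (h 3 le_rfl 2 le_rfl 576 1 1 fun _ hη => designAtNoDegree_576 hη.le)

/-! ## The cross terms `y ≠ y'`: without them `Y` is unconstrained -/

/-- The design clause with the separator constrained only on tuples with `y' = y` (no cross terms).
[folklore] -/
def DesignAtNoCross (n s N₁ N₂ N₃ : ℕ) (η : ℝ) : Prop :=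
  ∃ X Y Z : Finset (Matrix.GeneralLinearGroup (Fin n) ℂ), N₁ ≤ X.card ∧ N₂ ≤ Y.card ∧ N₃ ≤ Z.card ∧ (∀ x ∈ X, ∀ x' ∈ X, ∀ y ∈ Y, ∀ y' ∈ Y, ∀ z ∈ Z, ∀ z' ∈ Z, x * y⁻¹ * y' * z⁻¹ = x' * z'⁻¹ → x = x' ∧ y = y' ∧ z = z') ∧ ∀ x₀ ∈ X, ∀ z₀ ∈ Z, ∃ p : MvPolynomial (Fin n × Fin n) ℂ, p.totalDegree ≤ s ∧ ∀ x ∈ X, ∀ y ∈ Y, ∀ z ∈ Z, ((x = x₀ ∧ z = z₀) → ‖MvPolynomial.eval (fun ij : Fin n × Fin n => ((x * y⁻¹ * y * z⁻¹ : Matrix.GeneralLinearGroup (Fin n) ℂ) : Matrix (Fin n) (Fin n) ℂ) ij.1 ij.2) p - 1‖ ≤ η) ∧ (¬ (x = x₀ ∧ z = z₀) → ‖MvPolynomial.eval (fun ij : Fin n × Fin n => ((x * y⁻¹ * y * z⁻¹ : Matrix.GeneralLinearGroup (Fin n) ℂ) : Matrix (Fin n) (Fin n) ℂ) ij.1 ij.2)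 p‖ ≤ η)

/-- Forgetting the cross terms: specialise the separator clause to `y' = y`. [folklore] -/
theorem designAtNoCross_of_designAt {n s N₁ N₂ N₃ : ℕ} {η : ℝ} (h : DesignAt n s N₁ N₂ N₃ η) :
    DesignAtNoCross n s N₁ N₂ N₃ η := by
  obtain ⟨X, Y, Z, hX, hY, hZ, htpp, hsep⟩ := h
  refine ⟨X, Y, Z, hX, hY, hZ, htpp, fun x₀ hx₀ z₀ hz₀ => ?_⟩
  obtain ⟨p, hp, hsep⟩ := hsep x₀ hx₀ z₀ hz₀
  refine ⟨p, hp, fun x hx y hy z hz => ?_⟩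
  obtain ⟨h1, h0⟩ := hsep x hx y hy y hy z hz
  exact ⟨fun hh => h1 ⟨hh.1, rfl, hh.2⟩, fun hh => h0 fun hh' => hh ⟨hh'.1, hh'.2.2⟩⟩

/-- **Without cross terms `Y` is free**: `X = Z = {1}`, `Y` = the 576 design points, `p = 1`. [folklore] -/
theorem designAtNoCross_576 (s : ℕ) {η : ℝ} (hη : 0 ≤ η) : DesignAtNoCross 3 s 1 576 1 η := by
  classical
  set Y : Finset (Matrix.GeneralLinearGroup (Fin 3) ℂ) :=
    (Finset.univ : Finset Param).image fun p => toGL (design576 p) with hY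
  have hinj : Function.Injective fun p : Param => toGL (design576 p) := fun p q h =>
    design576_injective (toGL_inj (design576_good p).2 (design576_good q).2 h)
  have hcard : Y.card = 576 := by
    rw [hY, Finset.card_image_of_injective _ hinj, Finset.card_univ, card_param576]
  refine ⟨{1}, Y, {1}, by simp, hcard.ge, by simp, ?_, ?_⟩
  · intro x hx x' hx' y _ y' _ z hz z' hz' h
    simp only [Finset.mem_singleton] at hx hx' hz hz'
    subst hx hx' hz hz'
    have h' : y⁻¹ * y' = 1 := by simpa using h
    exact ⟨rfl, inv_mul_eq_one.1 h', rfl⟩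
  · intro x₀ hx₀ z₀ hz₀
    refine ⟨1, by simp, fun x hx y _ z hz => ?_⟩
    simp only [Finset.mem_singleton] at hx hx₀ hz hz₀
    subst hx hx₀ hz hz₀
    exact ⟨fun _ => by simp [hη], fun hh => (hh ⟨rfl, rfl⟩).elim⟩

/-- Deleting the cross terms is a STRENGTHENING of the crux (statement written out). [folklore] -/
theorem separationDegreeCost_of_noCross
    (h : ∀ n : ℕ, 3 ≤ n → ∀ s : ℕ, 2 ≤ s → ∀ N₁ N₂ N₃ : ℕ,
      (∀ η : ℝ, 0 < η → DesignAtNoCross n s N₁ N₂ N₃ η) → Conclusion n s N₁ N₂ N₃) :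
    SeparationDegreeCost :=
  fun n hn s hs N₁ N₂ N₃ hd => h n hn s hs N₁ N₂ N₃ fun η hη => designAtNoCross_of_designAt (hd η hη)

/-- The conclusion is symmetric in `N`: `(3, 2, 1, 576, 1)` fails like `(3, 2, 576, 1, 1)`. [folklore] -/
theorem not_conclusion_1_576_1 : ¬ Conclusion 3 2 1 576 1 := by
  intro h
  apply not_conclusion_576
  unfold Conclusion at h ⊢
  have e : ((576 : ℕ) : ℝ) * ((1 : ℕ) : ℝ) * ((1 : ℕ) : ℝ) = ((1 : ℕ) : ℝ) * ((576 : ℕ) : ℝ) * ((1 : ℕ) : ℝ) := by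
    push_cast; ring
  rw [e]
  exact h

/-- **The cross terms are load-bearing**: the vanishing of the separators at `x y⁻¹ y' z⁻¹`, `y ≠ y'`,
is exactly what makes `|Y|` enter the price; without it `N₂` is unbounded at fixed `(n, s)`. [folklore] -/
theorem separationDegreeCost_noCross_false :
    ¬ ∀ n : ℕ, 3 ≤ n → ∀ s : ℕ, 2 ≤ s → ∀ N₁ N₂ N₃ : ℕ,
      (∀ η : ℝ, 0 < η → DesignAtNoCross n s N₁ N₂ N₃ η) → Conclusion n s N₁ N₂ N₃ :=
  fun h => not_conclusion_1_576_1 (h 3 le_rfl 2 le_rfl 1 576 1 fun _ hη => designAtNoCross_576 2 hη.le)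

end SeparationDegreeCostNeg

end Summit.MatrixMultiplication.MatrixMultiplication.Theorems
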